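import Summits.SmoothPoincare4.SmoothPoincare4.Theorems.EntropyRungCompactShrinkerGapJensenVolumeBound
import Literature.Geometry.Lorentzian.VolumePositivity
import HarnessLib

/-!
# The potential of a closed normalised 4-d gradient shrinker is `≡ 2` or crosses `2`
(stub `helper_potentialCrossesTwo` of line `cgy-variance-pivot`, crux
`EntropyRung.CompactShrinkerGap`, item stmt-SmoothPoincare4-10870; first entry of the
critical-point dictionary for the Morse door)

For a Riemannian metric `g` (Levi-Civita connection) on a closed `4`-manifold `M` and a smooth
`f` with `Ric + Hess f = g/2` and `R + |∇f|² = f` (a normalised gradient shrinker, `τ = 1`),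
either `f ≡ 2` (the Einstein case) or `f` takes values strictly below **and** strictly above `2`.

Proof: the landed identity `∫ f e^{-f} dV = 2 ∫ e^{-f} dV` (`integral_mul_exp_neg_eq_two_mul`,
the integrated form of `Δ(e^{-f}) = (f − 2) e^{-f}`) says `∫ (f − 2) e^{-f} dV = 0`. If `f`
never drops below `2` the integrand is continuous, non-negative and of zero integral, hence
vanishes identically because the Riemannian measure charges non-empty open sets
(`isOpenPosMeasure_riemannianMeasure`), so `f ≡ 2`; symmetrically if `f` never exceeds `2`.

* `eq_zero_of_integral_eq_zero_of_nonneg_of_isOpenPosMeasure` — measure-theoretic core: a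
  continuous non-negative integrable function with zero integral against an `IsOpenPosMeasure`
  vanishes everywhere;
* `helper_potentialCrossesTwo` — the registered stub.

References: H.-D. Cao, R. S. Hamilton, T. Ilmanen, arXiv:math/0404165, §4
[CaoHamiltonIlmanen2004]; J. A. Carrillo, L. Ni, Comm. Anal. Geom. 17 (2009), §2 (2.1)–(2.3)
and §4 [CarrilloNi2009].
-/

-- the registered namespace `Summit.SmoothPoincare4.SmoothPoincare4.Theorems` repeats a component
set_option linter.dupNamespace false

noncomputable section

open MeasureTheory Set Function Filter
open scoped Manifold ContDiff Topology ContinuousMap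

namespace Summit.SmoothPoincare4.SmoothPoincare4.Theorems

open Literature.Geometry Literature.Geometry.Lorentzian Literature.Geometry.Riemannian
  Literature.Geometry.Lorentzian.PseudoRiemannianMetric

/-! ## Measure-theoretic core -/

/-- **A continuous non-negative function with zero integral vanishes** when the measure is
positive on non-empty open sets: `0 ≤ φ`, `φ` continuous and integrable, `∫ φ dμ = 0` give
`φ x = 0` for every `x` (`integral_eq_zero_iff_of_nonneg` makes `φ = 0` a.e., and two
continuous functions which agree a.e. for an `IsOpenPosMeasure` agree everywhere,
`Continuous.ae_eq_iff_eq`). [folklore] -/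
theorem eq_zero_of_integral_eq_zero_of_nonneg_of_isOpenPosMeasure {α : Type*}
    [TopologicalSpace α] [MeasurableSpace α] (μ : Measure α) [μ.IsOpenPosMeasure] {φ : α → ℝ}
    (hφc : Continuous φ) (hφnn : ∀ x, 0 ≤ φ x) (hφint : Integrable φ μ)
    (hφ0 : ∫ x, φ x ∂μ = 0) (x : α) : φ x = 0 := by
  have hae : φ =ᵐ[μ] 0 := (integral_eq_zero_iff_of_nonneg (fun y ↦ hφnn y) hφint).1 hφ0
  have hzero : φ = 0 := (hφc.ae_eq_iff_eq μ continuous_const).1 hae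
  simpa using congrFun hzero x

/-! ## The dichotomy for the potential -/

/-- **STUB `helper_potentialCrossesTwo` of line `cgy-variance-pivot` — the potential of a
closed normalised 4-d gradient shrinker is `≡ 2` or crosses `2`.** For `Ric + Hess f = g/2`,
`R + |∇f|² = f`, smooth `f`, Riemannian `g` (Levi-Civita) on a closed 4-manifold: either
`f x = 2` for all `x` (Einstein case, e.g. round `S⁴(√6)`), or there are points with `f < 2`
and points with `2 < f`. Proof: `∫ (f − 2) e^{-f} dV = 0` (`integral_mul_exp_neg_eq_two_mul`);
if `2 ≤ f` (resp. `f ≤ 2`) everywhere then `(f − 2) e^{-f}` (resp. `(2 − f) e^{-f}`) is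
continuous, non-negative, of zero integral, hence `≡ 0` since the Riemannian measure is
positive on non-empty open sets (`isOpenPosMeasure_riemannianMeasure`), i.e. `f ≡ 2`.
[cite: CaoHamiltonIlmanen2004, §4] [cite: CarrilloNi2009, §4] -/
theorem helper_potentialCrossesTwo :
    ∀ (M : Type) [TopologicalSpace M] [T2Space M] [SecondCountableTopology M]
      [ChartedSpace (EuclideanSpace ℝ (Fin 4)) M] [IsManifold (𝓡 4) ∞ M] [CompactSpace M]
      [T3Space M] [MeasurableSpace M] [BorelSpace M]
      (g : Literature.Geometry.Lorentzian.PseudoRiemannianMetric (𝓡 4) ∞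
        (EuclideanSpace ℝ (Fin 4)) (TangentSpace (𝓡 4) : M → Type _)) [g.HasLeviCivita]
      (f : M → ℝ) (hg : g.IsRiemannian),
      ContMDiff (𝓡 4) 𝓘(ℝ, ℝ) ∞ f →
      (∀ (x : M) (X Y : TangentSpace (𝓡 4) x),
        g.ricci x X Y + g.hessian f x X Y = (1 / 2 : ℝ) * g.val x X Y) →
      (∀ x : M, g.scalarCurvature x + g.gradSq f x = f x) →
      (∀ x : M, f x = 2) ∨ ((∃ x : M, f x < 2) ∧ (∃ x : M, 2 < f x)) := by
  intro M _ _ _ _ _ _ _ _ _ g _ f hg hf hsol hnorm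
  set μ := riemannianMeasure (g.toContMDiffRiemannianMetric hg) with hμ
  have hid := integral_mul_exp_neg_eq_two_mul M g f hg hf hsol hnorm
  haveI : IsFiniteMeasure μ :=
    ⟨riemannianVolume_lt_top_of_isCompact_holds (g.toContMDiffRiemannianMetric hg) le_rfl
      isCompact_univ⟩
  haveI : μ.IsOpenPosMeasure := isOpenPosMeasure_riemannianMeasure _
  have hV : g.riemVolume = μ := PseudoRiemannianMetric.riemVolume_eq hg
  have hfc : Continuous f := hf.continuous
  have hec : Continuous fun x ↦ Real.exp (-f x) := Real.continuous_exp.comp hfc.neg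
  have hint : Integrable (fun x ↦ Real.exp (-f x)) μ := hV ▸ integrable_exp_neg_of_contMDiff hf
  have hfint : Integrable (fun x ↦ f x * Real.exp (-f x)) μ :=
    hV ▸ g.integrable_of_continuous (hfc.mul hec)
  -- the integrand `ψ = (f − 2) e^{-f}` of zero integral
  set ψ : M → ℝ := fun x ↦ (f x - 2) * Real.exp (-f x) with hψ
  have hψc : Continuous ψ := (hfc.sub continuous_const).mul hec
  have hψint : Integrable ψ μ := (hfint.sub (hint.const_mul 2)).congr
    (ae_of_all _ fun x ↦ by simp only [Pi.sub_apply]; ring)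
  have hψ0 : ∫ x, ψ x ∂μ = 0 := by
    have h1 : ∫ x, ψ x ∂μ =
        ∫ x, f x * Real.exp (-f x) ∂μ - ∫ x, 2 * Real.exp (-f x) ∂μ := by
      rw [← integral_sub hfint (hint.const_mul 2)]
      exact integral_congr_ae (ae_of_all _ fun x ↦ by ring)
    rw [h1, integral_const_mul, hid]
    ring
  -- `ψ x = 0` forces `f x = 2` since `e^{-f x} > 0`
  have hkey : ∀ x, ψ x = 0 → f x = 2 := by
    intro x hx
    have hx' : (f x - 2) * Real.exp (-f x) = 0 := hx
    rcases mul_eq_zero.1 hx' with h | h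
    · linarith
    · exact absurd h (Real.exp_pos _).ne'
  by_cases hlt : ∃ x : M, f x < 2
  · by_cases hgt : ∃ x : M, 2 < f x
    · exact Or.inr ⟨hlt, hgt⟩
    · -- `f ≤ 2` everywhere: `-ψ ≥ 0` has zero integral, so `f ≡ 2`
      left
      have hle : ∀ x, f x ≤ 2 := fun x ↦ not_lt.1 (not_exists.1 hgt x)
      have hnn : ∀ x, 0 ≤ -ψ x := fun x ↦ by
        have h1 : f x - 2 ≤ 0 := sub_nonpos.2 (hle x)
        have h2 : 0 < Real.exp (-f x) := Real.exp_pos _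
        show 0 ≤ -((f x - 2) * Real.exp (-f x))
        nlinarith
      have h0 : ∫ x, -ψ x ∂μ = 0 := by rw [integral_neg, hψ0, neg_zero]
      intro x
      exact hkey x (neg_eq_zero.1
        (eq_zero_of_integral_eq_zero_of_nonneg_of_isOpenPosMeasure μ hψc.neg hnn hψint.neg h0 x))
  · -- `2 ≤ f` everywhere: `ψ ≥ 0` has zero integral, so `f ≡ 2`
    left
    have hle : ∀ x, 2 ≤ f x := fun x ↦ not_lt.1 (not_exists.1 hlt x)
    have hnn : ∀ x, 0 ≤ ψ x := fun x ↦
      mul_nonneg (sub_nonneg.2 (hle x)) (Real.exp_pos _).le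
    intro x
    exact hkey x (eq_zero_of_integral_eq_zero_of_nonneg_of_isOpenPosMeasure μ hψc hnn hψint hψ0 x)

end Summit.SmoothPoincare4.SmoothPoincare4.Theorems

end
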